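import Summits.ResolutionOfSingularities.ResolutionOfSingularities.Theorems.ProximityCutClasses
import HarnessLib

/-!
# CoefficientCutClasses — decomp-res node «CoefficientCut» (lens-5 g19 rev 1) refining the MaxContactCut aside
31770; tree file 1/4 of the node

Content VERBATIM from the decomp-res lens-5 g19 file `HOME/decomp-res-lens-5/g19/CoefficientCut.lean` rev 1 (sha256
e823b9913123731a ≡
`parts/CoefficientCut-NODE-rev1-e823b991.lean`, 759 l; statements identical to the graded NODE pin e42372fd).  HOME =
run/shared/lean/pub/decomp-res.  Critic: CRITIC-LEDGER rows 135 / 135a CLEARED (DECIDED-MOD-PORT(KNOWN) +1 · MAP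
+1), landing orders
2026-08-30T19:29:50Z / 19:36:14Z.  Host: route `MaxContactCut`, aside 31770 `MaxContactCut.DefectWalksDeep` BY NAME
through the tree's
`ExitLaw.defectWalksDeep_iff_joint'` and the lens-5 g18 node `Theorems/PlanarCut*` + `MaxContactCutPlanarCut`.

Route-independent, OUTSIDE the Theses cone (importable by the route file for the asides): PIECE 1′
`NoPlanarJointTailsDeep` (the planar
WINDOW, DECIDED-MOD-PORT in `MaxContactCutCoefficientCut.planar_iff_monomial`), PIECE 2 `NoSkewJointTailsDeep` (THE
LOCATED RESIDUAL: skew tails),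
both VERBATIM, and PIECE 1 in cone-free letters `NoMonomialLedPlanarJointTailsDeep` (PORT · COSTUME(cite)) with
`IsMonomialLed`.
Kernels, the lens-letter PIECE 1, the node equation and `closes`: `MaxContactCutCoefficientCut`; laws:
`CoefficientCutLaws` / `CoefficientCutTangency`.

[WRITER NOTE (decomp-res writer g7): split by the critic's order into `CoefficientCutClasses` (CONE-FREE: the two
classes whose binders use
only tree-free vocabulary — `NoPlanarJointTailsDeep`, `NoSkewJointTailsDeep` VERBATIM — plus the writer's
cone-free restatement
`NoMonomialLedPlanarJointTailsDeep` of PIECE 1 with the PlanarCut letters `sm (layer k a F) i j = 0` spelled out as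
`IsMonomialLed`, so that
the route file can import the two asides; the in-cone wiring file proves the restatement EXACT:
`monomialPlanar_iff_monomialLed`),
`CoefficientCutLaws` (§1–§3, PROVED, imports `MaxContactCutPlanarCut`), `CoefficientCutTangency` (§3b, PROVED)
and `MaxContactCutCoefficientCut`
(§4 VERBATIM: PIECE 1 `NoMonomialPlanarJointTailsDeep` in the lens's letters, the node equation, `closes`, the
exact cut, necessities — plus the
writer's link §4w).  ONE namespace `…Theorems.CoefficientCut` as in the lens; global `set_option` line dropped;
nothing else changed.]

## The lens's node description (VERBATIM)

# CoefficientCut — decomp-res node «CoefficientCut» (lens-5 «finite/base range + asymptotic regime + bridge», g19; rev 1: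
PIECE-1 cites K–M p. 2/p. 5 added, port memo `PORT.md`, companion `DifferentialShadeSettles.lean` — statements unchanged)

TARGET (tree, BY NAME): the joint residual `ExitLaw.NoRepeatTranslationRecurrentExcessPlateauxDeep` of the aside
31770 `MaxContactCut.DefectWalksDeep` (tree `ExitLaw.defectWalksDeep_iff_joint'`: 31770 `⟺` deep arc law `∧` joint
residual; lens-5 g18 rev 1, tree `PlanarCut.joint_iff_nonComponentPlanar`: the joint residual `≡` its located form
«every planar tail is a GHOST tail whose wall does not divide `F`»).

THE NODE — ONE EQUIV, proved hypothesis-free (`joint_iff_monomial_skew`), with a split beneath it: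
    joint residual `⟺` `NoMonomialPlanarJointTailsDeep` [PIECE 1 · PORT · COSTUME(cite) + WEAKER]
                    `∧` `NoSkewJointTailsDeep`          [PIECE 2 · RESIDUAL · UNDECIDED(stated test) + WEAKER · LOCATED]
and `closes : NoFreePointTailsDeep → PIECE 1 → PIECE 2 → MaxContactCut.DefectWalksDeep` (the arc law enters exactly
as in the tree's `PlanarCut.closes`).

THE LEVER — the COEFFICIENT DATUM of the NON-maximal-contact plane.  g18 cut the joint residual by the planes
`u_k = 0` the walk eventually RESPECTS (never the chart, never translated along) and killed, with the wall potential
`pot`, the case where the wall DIVIDES `F` (layer `0` empty).  For a GHOST wall (layer `0 ≠ ∅`) no wall potential is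
monotone (census `census/planar/kangaroo/T-kangaroo-0.md`: a forced `+1` regain in layer `0`; `census/T-planar-1.md`:
no violation-free linear potential).  This node separates the layers: the POSITIVE layers `a = 1 … q−1` — the
coefficients `G⁽ᵃ⁾(u_i,u_j)` of `u_k^a` in `F`, i.e. the coefficient-ideal datum of the pair (`F`, `H = {u_k = 0}`)
— transform AUTONOMOUSLY under every planar move whatever layer `0` does (tree `coeff_pointTransform_planar`;
cleaning only deletes `q`-th powers, which live in layers `≡ 0 mod q`), so THEIR potential `potPos` still dies at
the proximity repeats (§1): every planar tail of the joint residual reaches, IN KERNEL, the MONOMIAL REGIME — every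
positive layer monomial-led for ever (`sm = 0`: its exponent set has a componentwise least element, i.e. `G⁽ᵃ⁾` =
monomial × unit in the local ring of the plane).  What is left moving is ONE purely inseparable equation
`Z^q + G⁽⁰⁾(u_i,u_j)` over a regular SURFACE germ, twisted by MONOMIAL marks `(G⁽ᵃ⁾, q − a)`: a differential Rees
algebra / idealistic filtration with `τ ≥ 1` on the regular 3-FOLD `(Z,u_i,u_j)` (EVENTUAL COORDINATE CONTACT drops
the ambient dimension from 4 to 3) whose amplifying marks are already monomial — inside the PRINTED dimension-three
theorems (Benito–Villamayor 2012: Thm 2.11 + Thm 3.3 + §4, `d = 3 → d' = 2`; Kawanoue–Matsuki arXiv:1205.4556: the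
local algorithm for idealistic filtrations in dimension 3, §4–§5), strictly below the open two-`p`-polynomial problem
`MaxContactCut.RungTwo` (dimension 4, `τ ≥ 2`).  The identification «the chain of germs of the planar tail is
dominated by a run of the printed algorithm on the restricted datum» is the PORT (piece 1).

KERNEL CONTENT (all PROVED; 0 `sorry`; axioms standard):
* §1 `potPos` descends on ANY planar tail and dies at the repeats (`potPos_succ_succ_le`, `exists_potPos_eq_zero`,
  `exists_dead_pos`): the monomial regime is REACHED — the tree's `pot_*` calculus with its «layer `0` empty»
  hypothesis REMOVED;
* §2–§3 two PROFILE LAWS of the monomial regime, at every TRANSLATED move `t`: THIN — the new layer `0` has an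
  exponent with `d_{j_t} < q` (`layer_zero_thin_after_translated`); LOW — the old layer `0` has an exponent of
  degree `< 2q`, so `ord₀ F_t < 2q` and the excess `m_t = ord₀ F_t − q < q` (`layer_zero_low_at_translated`,
  `ordZero_lt_at_translated`).  Mechanism: otherwise the new state is fat off the translation axis
  (`fat_pos_of_dead_pos` — the tree's `fat_of_dead_layers` without its layer-`0` hypothesis — and the tree's
  `not_isolatedTop_of_fat`), contradicting `ForcedWalk.isolated`;
* §3b the FREE-POINT TANGENCY LAW of layer `0` (independent of the monomial regime): at ANY planar move landing
  in excess, every row `q < n < 2q` of layer `0` is tangent to order `2q − n + 1` at the free point — its row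
  polynomial's Taylor coefficients `l ≤ 2q − n` vanish (`row_tangency_at_planar_move`, via the layer-`0` row
  identity `coeff_step_row_zero`), so every non-empty such row REACHES `d_i ≥ 2q + 1 − n`
  (`row_reach_at_planar_move`) — the layer-`0` companion, one storey up, of the tree's degree-`q` free-point laws;
* §4 the three classes; the KERNEL REDUCTION `noPlanarJointTails_of_monomial` (tree law for dividing walls + §1);
  the node equation; `closes`; the exact cut `defectWalksDeep_iff_monomial_skew`; necessity of each piece; and
  `profile_of_monomialPlanar` (the profile laws stated on piece 1's class, hypothesis-free).

WHY NOVEL.  First use, on this summit, of the coefficient ideal with respect to a NON-maximal-contact hypersurface —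
the plane handed over by planarity, not a hypersurface of maximal contact (which does not exist here): it turns the
ghost-planar residual, on which every wall potential tried so far regains, into a DIMENSION DROP to a surface base
with monomial boundary marks, i.e. into print — with the reduction to the monomial regime carried out in kernel, not
assumed.  No earlier decomp-res node restricts to a plane: lens-2's ports are maximal-contact eliminations of the
purely inseparable variable itself (dimension 4 → 3), lens-5 g18's law needs the wall to divide `F`, lens-3/4/6 cut
by shade / boundary arcs / tail order.

WHY EACH PIECE IS STRICTLY WEAKER (by letter; must-fail probes in `bc/Probe.lean`): piece 1 = joint binders + a
planar tail + layer `0` non-empty + positive layers monomial-led (three extra hypotheses; `monomial_of_planar ∘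
planar_of_joint`), not known to give the joint residual (probe P1 fails) and claimed KNOWN modulo the port; piece 2 =
joint binders + «no planar tail» (`skew_of_joint`), not known to give the joint residual (P3 fails), UNDECIDED with a
stated census test.  Together they are EXACTLY the joint residual.

NOT CLAIMED / RULED OUT: (i) the multiplicity ledger plus the LOW law do NOT kill piece 1 by bookkeeping — on a planar
tail of shade `n < q` the symbolic dynamics «`m ↦ m + n − q` at a translated move (allowed only while `m < q`),
`m ↦ m + n − q + r_{c'}` at an untranslated one» has admissible cycles (e.g. `q = 8`, `n = 7`: translated,
translated, untranslated chart-switch, with `m = 4, 3, 2, 4, …`), so the port's printed content (B–V's invariant on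
the restricted presentation) is genuinely needed; (ii) no layer-`0` potential is claimed monotone; (iii) nothing here
bears on skew tails; (iv) the forced walk is not claimed to be verbatim a run of either printed algorithm.

(Sources: BenitoVillamayor2012 Thm. 2.11, Thm. 3.3, §4; KawanoueMatsuki2016 §4–§5 (arXiv:1205.4556 pp. 2, 5,
7); Hauser2010 §§D–G; HauserPerlega2019; CossartJannsenSaito2020 Thm. 2.14; CossartPiltant2019; Moh1987.)
-/

noncomputable section

open MvPolynomial Finset
open Literature.AlgebraicGeometry.Resolution
open Literature.AlgebraicGeometry.Resolution.Hauser2010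
open Literature.AlgebraicGeometry.Resolution.PointBlowup
open Literature.AlgebraicGeometry.Resolution.WeightedBlowup
open Summit.ResolutionOfSingularities.ResolutionOfSingularities.Theorems.TightDefectClasses
open Summit.ResolutionOfSingularities.ResolutionOfSingularities.Theorems.TightDefectStrongWalks
open Summit.ResolutionOfSingularities.ResolutionOfSingularities.Theorems.ItineraryCutClasses
open Summit.ResolutionOfSingularities.ResolutionOfSingularities.Theorems.ProximityCut

namespace Summit.ResolutionOfSingularities.ResolutionOfSingularities.Theorems.CoefficientCut

/-! ## §4 (classes with tree-free binders, VERBATIM) the planar WINDOW and the SKEW residual -/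

/-- PIECE 1′ · WINDOW · **ALL PLANAR TAILS OF THE JOINT RESIDUAL** (ghost walls INCLUDED: no multiplicity /
divisibility hypothesis on the wall) · the joint residual's binders VERBATIM + ONE planar tail · tags:
DECIDED-MOD-PORT (`noPlanarJointTails_of_monomial`: the KERNEL reduces it to the monomial planar case —
`planar_iff_monomial`, EXACT) · WEAKER(evidence: sub-case of the joint residual, `planar_of_joint`; P2 must-fail). -/
def NoPlanarJointTailsDeep : Prop :=
  ∀ p : ℕ, p.Prime → ∀ e : ℕ, 2 ≤ e → ∀ (K : Type) [Field K] [CharP K p] [PerfectField K] [DecidableEq K]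
    (s₀ : State (Fin 3) K), IsRoot (p ^ e) s₀ → ∀ W : ForcedWalk (p ^ e) s₀, (∀ i, 1 ≤ (W.st i).shade) →
    ∀ N : ℕ, (∀ t, N ≤ t → (W.st (t + 1)).shade = (W.st t).shade) →
    (∀ t, N ≤ t → ordZero (W.st t).F ≠ ((p ^ e : ℕ) : ℕ∞)) →
    (∀ M : ℕ, ∃ t, M ≤ t ∧ StaysOnNewest W t) → (∀ M : ℕ, ∃ t, M ≤ t ∧ W.b t ≠ 0) →
    ∀ (k : Fin 3) (N' : ℕ), (∀ t, N' ≤ t → W.j t ≠ k ∧ W.b t k = 0) → False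

/-- PIECE 2 · RESIDUAL · **SKEW TAILS** · the joint residual's binders VERBATIM + «NO planar tail at all»: every
coordinate plane `u_k = 0` is, infinitely often, the chart or the direction of a translation — the walk keeps
turning through all three coordinates while repeating and translating on an excess plateau · tags:
UNDECIDED(stated test: census ask T-planar-7b — among excess-plateau stretches of root walks with ≥ 1 proximity
repeat and ≥ 1 translated move, count the SKEW ones (all three coordinates charted-or-translated inside the stretch)
against the planar ones, per bed K0/K2/K3 of `census/planar/planar6/`; 0 skew stretches of length ≥ L for growing L
is the finite-window shadow of this class being empty) · WEAKER(evidence: sub-case of the joint residual BY LETTER,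
`skew_of_joint`; not known to imply it: P3 must-fail) · LOCATED (`≡` the joint residual GIVEN piece 1:
`joint_iff_skew_of_monomial`; EXACT complement of the planar window: `joint_iff_planar_skew`) · leaf: IDEA-NEEDED
(no respected plane ⇒ no regular surface base for a coefficient datum; candidate levers: a two-plane run-length law,
the Kawanoue–Matsuki stall analysis of the alternating case) ∧ INSTRUMENTABLE (T-planar-7b). -/
def NoSkewJointTailsDeep : Prop :=
  ∀ p : ℕ, p.Prime → ∀ e : ℕ, 2 ≤ e → ∀ (K : Type) [Field K] [CharP K p] [PerfectField K] [DecidableEq K]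
    (s₀ : State (Fin 3) K), IsRoot (p ^ e) s₀ → ∀ W : ForcedWalk (p ^ e) s₀, (∀ i, 1 ≤ (W.st i).shade) →
    ∀ N : ℕ, (∀ t, N ≤ t → (W.st (t + 1)).shade = (W.st t).shade) →
    (∀ t, N ≤ t → ordZero (W.st t).F ≠ ((p ^ e : ℕ) : ℕ∞)) →
    (∀ M : ℕ, ∃ t, M ≤ t ∧ StaysOnNewest W t) → (∀ M : ℕ, ∃ t, M ≤ t ∧ W.b t ≠ 0) →
    (∀ (k : Fin 3) (N' : ℕ), ∃ t, N' ≤ t ∧ (W.j t = k ∨ W.b t k ≠ 0)) → False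

/-! ## §4w (writer g7 · cone-free letters for PIECE 1) -/

/-- MONOMIAL-LED exponent sets (writer g7, cone-free spelling of the PlanarCut letter `sm S i j = 0`): a finite set `S` of
exponents is monomial-led in the plane coordinates `u_i, u_j` iff it is empty or has an element componentwise least in
`(d_i, d_j)` — i.e. the layer it describes is `u_i^{a} u_j^{b} ×` (unit in the local ring of the plane).  EXACT:
`PlanarCut.sm S i j = 0 ↔ IsMonomialLed S i j` (`MaxContactCutCoefficientCut.sm_eq_zero_iff_isMonomialLed`). [folklore] -/
def IsMonomialLed (S : Finset (Fin 3 →₀ ℕ)) (i j : Fin 3) : Prop :=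
  S = ∅ ∨ ∃ d ∈ S, ∀ d' ∈ S, d i ≤ d' i ∧ d j ≤ d' j

/-- PIECE 1 in CONE-FREE LETTERS (writer g7; the aside's home) · PORT · **THE MONOMIAL PLANAR CASE** — VERBATIM the lens's
`NoMonomialPlanarJointTailsDeep` (tree `MaxContactCutCoefficientCut`, same namespace) except that the last binder
`sm (layer k a (W.st t).F) i j = 0` (PlanarCut letters, inside the Theses cone) is spelled
`IsMonomialLed (((W.st t).F.support).filter (fun d => d k = a)) i j` (`PlanarCut.layer k a F` is by definition that filter).
EXACT: `NoMonomialPlanarJointTailsDeep ↔ NoMonomialLedPlanarJointTailsDeep` (`monomialPlanar_iff_monomialLed`,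
PROVED).  Tags as PIECE 1:
COSTUME(cite: BenitoVillamayor2012 = Math. Ann. 353 / arXiv:1103.3464 Thm 2.11 (p. 8) + Thm 3.3 + §4 cases A–D2
(pp. 12–17),
`d = 3 → d' = 2`; KawanoueMatsuki2016 = ASPM 70 / arXiv:1205.4556 p. 2 (the local algorithm for idealistic filtrations in
dimension 3, perfect fields by Galois descent), p. 5 (output `Sing = ∅`), p. 7 (the `τ = 1` monomial case),
§4–§5) · WEAKER (sub-case of
the joint residual BY LETTER, `monomial_of_planar ∘ planar_of_joint`; probe P1 must-fail) · leaf ATTACKABLE ∧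
INSTRUMENTABLE (T-planar-7a:
0 violations of the profile laws on the census polynomials).  DICTIONARY and obstruction argument: see PIECE 1's docstring in
`MaxContactCutCoefficientCut` and the lens memo `HOME/decomp-res-lens-5/g19/PORT.md`.
(Sources: BenitoVillamayor2012 Thm. 2.11, §4; KawanoueMatsuki2016 §4–§5.) -/
def NoMonomialLedPlanarJointTailsDeep : Prop :=
  ∀ p : ℕ, p.Prime → ∀ e : ℕ, 2 ≤ e → ∀ (K : Type) [Field K] [CharP K p] [PerfectField K] [DecidableEq K]
    (s₀ : State (Fin 3) K), IsRoot (p ^ e) s₀ → ∀ W : ForcedWalk (p ^ e) s₀, (∀ i, 1 ≤ (W.st i).shade) →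
    ∀ N : ℕ, (∀ t, N ≤ t → (W.st (t + 1)).shade = (W.st t).shade) →
    (∀ t, N ≤ t → ordZero (W.st t).F ≠ ((p ^ e : ℕ) : ℕ∞)) →
    (∀ M : ℕ, ∃ t, M ≤ t ∧ StaysOnNewest W t) → (∀ M : ℕ, ∃ t, M ≤ t ∧ W.b t ≠ 0) →
    ∀ (i j k : Fin 3), i ≠ j → j ≠ k → i ≠ k → (∀ t, N ≤ t → W.j t ≠ k ∧ W.b t k = 0) →
    (∀ t, N ≤ t → ∃ d ∈ (W.st t).F.support, d k = 0) →
    (∀ t, N ≤ t → ∀ a, 1 ≤ a → a < p ^ e →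
      IsMonomialLed (((W.st t).F.support).filter (fun d => d k = a)) i j) → False

end Summit.ResolutionOfSingularities.ResolutionOfSingularities.Theorems.CoefficientCut
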